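import Literature.MathematicalPhysics.QuantumFieldTheory.Balaban1983to89.B7Prop3Flat
import Literature.MathematicalPhysics.QuantumFieldTheory.Balaban1983to89.B7Prop2Explicit

/-!
# Bałaban's renormalization group for 4-d lattice Yang–Mills — B7 Proposition 4 (127)–(135) AT THE FLAT BACKGROUND
`U₀ = 1`: the `k`-th order "double-bar" average `U̿₁^k` (90)/(91) as the `k`-fold iterate of the one-step operation (89),
the composition `Q_k(U₀)` of the linear parts and its identification with the straight-line average over `L^k`-blocks
(B5 (1.18); p. 39 "A composition of `k` operators `Q` is the operator `Q_k`"), and the inductive bounds (128)–(133):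
`|Q_k(1, ηA) − L^kη·Q_k(1)A| ≤ C₂(L^kηα₁)²`, `|Q_j(1, ηA)| < 2α₁L^jη` ((131) = (161)), with the explicit witnesses
`C₂(d) = 8C₁(d) = 10048(d+1)²`, `c₄(d) = 1/(8C₁(d))`, UNIFORMLY IN `k`; and (v1.1, §3) the ANALYTICITY clause of
Prop. 4 ("is an analytic function of the variables `A_b`"), (134) in Fréchet form and (136) ("`C_k` … a sum of
homogeneous polynomials" beginning at second order) on the finite products `𝔸^S` (`B7Prop4Flat`)

CITATION HEADER (lean-in-tree rule 2026-08-18).  Audit cell `pub-balaban`, paper sub-cell B07 (unit b2b-balaban-b07,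
gen 17; v1.1 §3 gen 17, same seat).  Source: T. Bałaban, *Averaging operations for lattice gauge theories*, Commun. Math. Phys. **98**, 17–51
(1985) [Balaban1985Averaging] (cell paper B7; journal page = PDF page + 16), Sect. D pp. 37–39 [PDF 21–23] and p. 31
[PDF 15], quoted from the page renders `b2b-balaban-ref1/pages/1985-cmp98-averaging/1985-cmp98-averaging-p015-x2.png`,
`-p021-x2.png`, `-p022-x2.png`, `-p023-x2.png` READ AS IMAGES (2026-08-19); for the straight-line average `Q`, `Q_k`:
T. Bałaban, *Propagators and renormalization transformations for lattice gauge theories. I*, Commun. Math. Phys. **95**,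
17–40 (1984) [Balaban1984PropagatorsI] (cell paper B5), pp. 19–20 [PDF 3–4], renders
`1984-cmp95-propagators-rt-I-p003-x2.png`, `-p004-x2.png` READ AS IMAGES (2026-08-19).
Companions: `B7Prop3Flat` (the one-step objects at `V₀ = 1`: `dbavg` (89), `linQ` = `L·(Q₀A)_c` (122)/(125), `expCfg`,
`C1`, `c3`, and the one-step theorem `prop3_flat` (122)–(123), all REUSED), `B7Prop2Explicit` (`rescale`: the
identification `Ω^{(j)} = L^jηℤ^d ≅ ℤ^d` under which `Ū^j ↦ avgIter`; here `U̿₁^j ↦ dbavgIter` in the same way),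
`B7Prop1Explicit` (`Site`, `e`, `boxVec`, `seg`, `asum`, `expUnit`), `MatrixLog` (the series (21) `mlog`, `exp_mlog`),
`B7` (the quoted leaf `B7.Prop4Printed`/`B7.KExp`, NOT touched here — see ABSOLUTE-RULE LEDGER), `B7Prop5Induction` (the
operator-chain inductions (143)/(149) of Prop. 5, where (135) enters as a HYPOTHESIS; not imported).

THE PRINTED TEXT.  p. 31 (90): "U̿₁ = \overline{R(U₀)U₁}", (91): "U̿₁^{j+1} = \overline{R(Ū₀^j)U̿₁^j}, i.e., it is a
composition of the operation (89) for V₀ = Ū₀^j and of the j-th order operation U̿₁^j."  p. 37: "Now we will consider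
the k-th order average U̿₁^k. Its definition implies that (1/i) log U̿₁^k as a function of (1/i) log U₁ is a composition
of the functions Q(U₀, ·), Q(Ū₀, ·), …, Q(Ū₀^{k−2}, ·), Q(Ū₀^{k−1}, ·). (127) We assume that U₀ satisfies the
assumptions of Proposition 2 and U₁ = e^{iηA}, |A| < α₁. Then by this proposition the configurations Ū₀^j for j < k
satisfy the assumptions of Proposition 3 for V₀ = Ū₀^j if α₀L^{2j}η² + 2C₀(α₀L^{2j}η²)² ≤ 2α₀L^{2j}η² < α₀ ≤ c₃. We will
now investigate compositions of functions in the sequence (127). For the first function we have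
|Q(U₀, ηA) − LηQ(U₀)A| ≤ C₁(L|ηA|)² < C₁(α₁Lη)², hence |(1/(Lη))Q(U₀, ηA) − Q(U₀)A| < C₁Lηα₁², and
|(1/(Lη))Q(U₀, ηA)| < |Q(U₀)A| + C₁Lηα₁² < (1 + O(1)L²α₀η²)α₁ + C₁Lηα₁² < e^{O(1)L²η²α₀}α₁ + C₁Lηα₁². (128)
Because e^{O(1)L²η²α₀}α₁ + C₁Lηα₁² ≤ e^{O(1)α₀}α₁ + C₁α₁² ≤ 2α₁ for α₀, α₁ sufficiently small (O(1)α₀ ≤ 1/3,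
C₁α₁ ≤ 1/2), so |Q(U₀, ηA)| < 2α₁Lη ≤ 2α₁ ≤ c₃ for α₁ ≤ ½c₃, and we can apply Proposition 3 to function Q(Ū₀, ·)
calculated at Q(U₀, ηA). For this composition we have |Q(Ū₀, Q(U₀, ηA)) − L²ηQ(Ū₀)(1/(Lη))Q(U₀, ηA)| ≤
C₁(L²η)²|(1/(Lη))Q(U₀, ηA)|² < C₁(L²η)²(2α₁)², denoting Q(Ū₀, Q(U₀, ηA)) = Q₂(U₀, ηA), Q(Ū₀)Q(U₀) = Q₂(U₀), and
using (128) we get |(1/(L²η))Q₂(U₀, ηA) − Q₂(U₀)A| < e^{O(1)L⁴η²α₀}C₁Lηα₁² + 4C₁L²ηα₁² < e^{O(1)(L⁴+L²)η²α₀}4C₁(L +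
L²)ηα₁², |(1/(L²η))Q₂(U₀, ηA)| < … < e^{O(1)2α₀}(1 + 8C₁α₁)α₁ < 2α₁ for α₀, α₁ sufficiently small [e.g., O(1)α₀ ≤ 1/6,
8C₁α₁ ≤ 1/3]. (129)"  p. 38: "Continuing these arguments, we arrive at the following inductive assumption for the
composition Q_j(U₀, ηA) of the first j functions (127) and the composition Q_j(U₀) of their linear parts:
|(1/(L^jη))Q_j(U₀, ηA) − Q_j(U₀)A| < e^{O(1)(L^{2j}+…+L⁴+L²)η²α₀}·4C₁(L^j + … + L² + L)ηα₁². (130) This implies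
|(1/(L^jη))Q_j(U₀, ηA)| < … < e^{O(1)2α₀}(1 + 8C₁α₁)α₁ < 2α₁, (131) and for α₁ ≤ ½c₃ we can apply Proposition 3 to the
function Q(Ū₀^j, ·) calculated at Q_j(U₀, ηA), and we get |Q(Ū₀^j, Q_j(U₀, ηA)) − L^{j+1}ηQ(Ū₀^j)(1/(L^jη))Q_j(U₀, ηA)|
< C₁(L^{j+1}η)²|(1/(L^jη))Q_j(U₀, ηA)|² < 4C₁(L^{j+1}η)²α₁². (132) Applying (130) and denoting
Q_{j+1}(U₀, ηA) = Q(Ū₀^j, Q_j(U₀, ηA)), Q_{j+1}(U₀) = Q(Ū₀^j)Q_j(U₀), we have |(1/(L^{j+1}η))Q_{j+1}(U₀, ηA) −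
Q_{j+1}(U₀)A| < 4C₁L^{j+1}ηα₁² + … < e^{O(1)(L^{2(j+1)}+…+L²)η²α₀}4C₁(L^{j+1} + L^j + … + L)ηα₁². Thus the inductive
hypothesis (130) is proved for j ≤ k. For j = k, we have |Q_k(U₀, ηA) − Q_k(U₀)A| < e^{O(1)(1+L^{−2}+…+L^{−2(k−1)})α₀}
·4C₁(1 + L^{−1} + … + L^{−(k−1)})α₁² < e^{O(1)2α₀}8C₁α₁² = C₂α₁². (133) We formulate the obtained results in
**Proposition 4.** There exist constants C₂, c₄ such that for α₀, α₁ ≤ c₄ the function Q_k(U₀, ηA, c) =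
(1/i) log(U̿₁^k)_c, c ⊂ Ω^{(k)}, is an analytic function of the variables A_b, b ⊂ B^k(c₋)∪B^k(c₊). Further we have
Q_k(U₀, ηA) = Q_k(U₀)A + C_k(U₀, A), (134) and |C_k(U₀, A)| ≤ C₂|A|² < C₂α₁². (135)"  p. 39: "The constants C₂, c₄ are
independent of k, C₂ depends on d and c₄ depends on d and L. The function C_k can be decomposed further into a sum
of homogeneous polynomials, C_k(U₀, A) = C_k^{(2)}(U₀, A) + C_k^{(3)}(U₀, A) + … . (136)"; "If F(A) is a
differentiable function defined at field configurations A on Ω, then the differential dF(A, δA) =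
(d/dt) F(A + tδA)|_{t=0} (137) is a linear functional of the variable δA"; "|Q_{V₀}A| ≤ Q|A|, … (139)
where the operator Q is defined as in [2]"; "A composition of k operators Q is the operator Q_k."  B5 = [2], p. 19
(1.11): "(QA)_c = Σ_{x∈B(c₋)} L^{−(d+1)} A([x, x(c)])", "if c = ⟨y, y + Le_μ⟩ then x(c) = x + Le_μ"; p. 20: "Q₂ is
defined as Q only with the number L replaced by L² in all definitions. It is easily seen that a composition of k
transformations is given by (1.17) where (Q_kA)_b = Σ_{x∈B^k(b₋)} η^{d+1} A([x, x(b)]), b ⊂ T₁^{(k)} = ℤ^d ∩ T_η,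
η = L^{−k}, (1.18)".

THE FLAT BACKGROUND.  For `U₀ = 1` every `Ū₀^j = 1` ((42) of the unit configuration), so every factor of (127) is
the SAME one-step map `A ↦ Q(1, A)` of Prop. 3 at `V₀ = 1` (`B7Prop3Flat`: `Q(1, A, c) = (1/i) log V̿₁(c)`,
`V₁ = e^{A}`), applied on successively coarser lattices; `α₀ = 0` and every factor `e^{O(1)…α₀}` of (128)–(133)
equals `1`.  The linear part of the one-step map is `L·Q₀` ((122)/(125), `linQ`), and `Q_{j+1}(1) = Q₀Q_j(1)` is the
`(j+1)`-fold composition, which (B5 (1.16)–(1.18), B7 p. 39) is the straight-line average over `L^{j+1}`-blocks.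

DICTIONARY print ↦ Lean (conventions of `B7Prop3Flat`/`B7Prop2Explicit`: `𝔸` a complete normed `ℂ`-algebra for
`M_N(ℂ)`, the `i` and the `η` of `U₁ = e^{iηA}` absorbed into the bond field `B` (`‖B_b‖ ≤ b`, `b` playing `ηα₁`), the
lattices `Ω^{(j)} = L^jηℤ^d` all identified with `ℤ^d` by `rescale L W (z, κ) = W(Lz, κ)`).  (90)/(91) at `U₀ = 1` ↦
`dbavgIter L V j` (`dbavgIter L V (j+1) = rescale L (dbavg L (dbavgIter L V j))`: `(U̿₁^{j+1})` = the one-step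
double-bar average (89) of `U̿₁^j` read on the unit lattice); `Q_j(U₀, ηA)|_{U₀=1}` = `(1/i) log U̿₁^j` ↦
`logIter L B j` (`logIter L B (j+1) (z, κ) = log (dbavg L (e^{logIter L B j}) (Lz, κ))`, `logIter L B 0 = B`; identified
with `log ∘ dbavgIter` in `dbavgIter_eq_expCfg_logIter` / `mlog_dbavgIter`); `L^jη·Q_j(U₀)A|_{U₀=1}` (the linear part,
un-normalised as in (122)) ↦ `linQIter L B j` (`linQIter L B (j+1) (z, κ) = linQ L (linQIter L B j) (Lz, κ)`), `=`
(`linQIter_eq_linQ_pow`) `linQ (L^j) B (L^j z, κ) = Σ_{x∈B^j} L^{−jd} B([x, x + L^je_κ])` = `L^jη·(Q_jA)` of B5 (1.18);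
`C_k(1, A) = Q_k(1, ηA) − Q_k(1)A` (134) at `L^kη = 1` ↦ `logIter L B k − linQIter L B k`; `C₂` ↦ `C2 d = 8 * C1 d`;
`c₄` ↦ `c4 d = 1/(8 * C1 d)`; `|A| < α₁` with `L^kη = 1` ↦ the hypothesis `L^k·b ≤ c4 d` on `t_k := L^k·b`.
(§3, v1.1:) "the variables `A_b`, `b ⊂ B^k(c₋)∪B^k(c₊)`" ↦ a point `a ∈ 𝔸^S`, `S` any finite set of bonds of the unit
lattice, inserted by `B7Prop3Flat.insCfg S a` (`U₁ = e^{A}` on `S`, `U₁ = 1` off `S`); "`α₁ ≤ c₄`" ↦ the open polydisc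
`{∀ s, ‖a s‖ < c4 d / L^k}`; the homogeneous polynomials `C_k^{(n)}` of (136) ↦ the terms `p n (a, …, a)` of a
`FormalMultilinearSeries p` with `HasFPowerSeriesAt`; the differential (137) at `A = 0` ↦ `HasDerivAt` along `t ↦ t • v`.

WHAT THIS FILE PROVES (kernel, no `sorry`, standard axioms), for `L ≥ 2`, any `d`, any `k`:
* `linQ_comp` — B5 p. 20 "Q₂ is defined as Q only with the number L replaced by L²" / B7 p. 39 "A composition of k
  operators Q is the operator Q_k", for the straight-line averages with arbitrary block sizes `L`, `M`:
  `linQ L (linQ M B ∘ (M·)) (q) = linQ (L·M) B (Mq)` (an exact reindexing of finite sums: mixed-radix decomposition of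
  the box `[0, LM)^d` and of the segment `[0, LM)`); hence `linQIter_eq_linQ_pow`: `Q_j(1)` composed `j` times IS the
  `L^j`-block straight-line average (1.18).
* `prop3_flat_global` — Prop. 3 at `V₀ = 1` (`B7Prop3Flat.prop3_flat`) in the form used by the induction: a bond field
  with `sup_b |B_b| ≤ a ≤ c₃(d, L)` has `|log V̿₁(c) − L·(Q₀B)_c| ≤ C₁L²a²` and `|V̿₁(c) − 1| < 1` at every `c`.
* `prop4_flat_induction` — (128)–(132) at `U₀ = 1`: if `8C₁(d)·L^k·b ≤ 1` then for every `j ≤ k`: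
  `U̿₁^j = exp Q_j` bondwise (`dbavgIter L (e^B) j = e^{logIter L B j}`), (130) `|Q_j − L^jη·Q_jA| ≤ 8C₁(L^jb)²`
  (print: `< 4C₁(L^j + … + L)ηα₁²·L^jη ≤ 8C₁(L^jηα₁)²`), (131) = (161) `|Q_j| ≤ 2L^jb` ("< 2α₁L^jη").  The induction
  closes because `L·8C₁t_j² + 4C₁(Lt_j)² ≤ 8C₁(Lt_j)²` for `L ≥ 2` (this replaces print's geometric series) and
  `2t_j ≤ c₃(d, L)` for `j < k` follows from `256(d+1)t_k ≤ 8C₁t_k ≤ 1`.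
* `prop4_flat` — THE PRINTED SHAPE (134)–(135) at `U₀ = 1`, `k ≥ 1`: for `L^k·b ≤ c₄(d) = 1/(8C₁(d))`,
  `‖(1/i) log U̿₁^k(c) − L^kη·(Q_k A)_c‖ ≤ C₂(d)·(L^kb)²` with `C₂(d) = 8C₁(d) = 10048(d+1)²` INDEPENDENT OF `k` (and of
  `L`), `‖(1/i) log U̿₁^k(c)‖ ≤ 2L^kb`, and `U̿₁^k(c) = exp((1/i) log U̿₁^k(c))` (the logarithm is the series (21) on
  `|X − 1| < 1`); `prop4_flat_linQ_pow` — the same with the linear part written as the `L^k`-block average (1.18).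
* §3 (v1.1) `prop4_flat_analyticAt` — THE ANALYTICITY CLAUSE of Prop. 4 at `U₀ = 1`, parametrised form: for a bond
  field `B(t)` depending analytically (bondwise) on `t` in any complex normed space `E`, `sup_b ‖B(t₀)_b‖ ≤ b`,
  `8C₁(d)·L^k·b ≤ 1`: every `t ↦ Q_j(1, B(t))(c)`, `j ≤ k`, is analytic at `t₀` ((127): composite of the one-step maps,
  each analytic by `B7Prop3Flat.prop3_flat_analyticAt` on the domain supplied by (131)); `prop4_flat_analyticOnNhd_ins`
  / `prop4_flat_analyticOnNhd_mlog_ins` — THE PRINTED LETTER on `𝔸^S`: `(A_b)_{b∈S} ↦ Q_k(1, A)(c)` (resp. `(1/i) log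
  U̿₁^k(c)` itself, `k ≥ 1`) is analytic on a neighbourhood of every point of the polydisc `{‖A_b‖ < c₄(d)/L^k}`;
  `prop4_flat_ins` — (134)–(135), (131) on the closed polydisc; `hasDerivAt_logIter_ins_dir` / `hasFDerivAt_logIter_ins`
  — (134) IN FRÉCHET FORM: the derivative of `A ↦ Q_k(1, A)(c)` at `A = 0` is the continuous linear form
  `A ↦ L^kη·(Q_k(1)A)_c` ((137) along complex lines + the quadratic bound (130)); `prop4_flat_Ck_ins` /
  `prop4_flat_Ck_powerSeries` — (136): `C_k(1, ·)(c) = Q_k(1, ·)(c) − L^kη·Q_k(1)(·)_c` is analytic on the polydisc,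
  vanishes at `0` with vanishing Fréchet derivative, i.e. its power series at `0` has `p₀ = p₁ = 0` ("a sum of
  homogeneous polynomials `C_k^{(2)} + C_k^{(3)} + …`").

ABSOLUTE-RULE LEDGER.  Hypotheses of every theorem: NONE beyond the displayed smallness conditions; all objects are
the concrete `bavg` (42), `dbavg` (89)|_{V₀=1}, `rescale`, `linQ` of the tree.  No `B7.Prop*` placeholder is assumed,
nothing of the manuscript is cited as a fact; `B7.Prop4Printed` (curved background) is neither used nor
claimed.

DIVERGENCES from print (located; cell DIVERGENCE.md D-b07g17.1).  (a) FLAT BACKGROUND ONLY: `U₀ = 1` (`α₀ = 0`): the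
backgrounds `Ū₀^j`, Proposition 2, the factors `e^{O(1)(L^{2j}+…)η²α₀}` and the threshold in `α₀` are absent; the leaf
`B7.Prop4Printed` is NOT discharged.  (b) ANALYTICITY (v1.1, §3; v1 left it out): the clause "is an analytic function of the variables A_b,
b ⊂ B^k(c₋)∪B^k(c₊)" is rendered, as in `B7Prop3Flat` §5 (D-b07g16.3), (i) in PARAMETRISED form — analyticity of
`t ↦ Q_j(1, B(t))(c)` at `t₀` for any bondwise-analytic parametrisation `B : E → bond fields` by a complex normed space
`E` with `sup_b ‖B(t₀)_b‖ ≤ b`, `8C₁(d)L^kb ≤ 1` (`prop4_flat_analyticAt`) — and (ii) LITERALLY on the finite products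
`𝔸^S`, `S` ANY finite set of bonds of the unit lattice, the other bond variables frozen at `A_b = 0` (`insCfg`), on the
open polydisc `‖A_b‖ < c₄(d)/L^k` (`prop4_flat_analyticOnNhd_ins`; for `(1/i) log U̿₁^k(c)` itself, `k ≥ 1`,
`prop4_flat_analyticOnNhd_mlog_ins`) — print's dependence set `B^k(c₋)∪B^k(c₊)` is not singled out (locality holds by
construction; every `S` is allowed); (134) is rendered twice: as the INEQUALITY of v1 (`prop4_flat`: the remainder
`C_k` is the explicit difference `Q_k(1, A) − L^kη·Q_k(1)A`, not a named function) and (v1.1) in FRÉCHET form at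
`A = 0` (`hasFDerivAt_logIter_ins`: the derivative of `A ↦ Q_k(1, A)(c)` at `0` is the continuous linear form
`A ↦ L^kη·(Q_k(1)A)_c`, obtained from (137) along complex lines and the quadratic bound (130)); (136) is rendered as:
`C_k(1, ·)(c)` is analytic on the polydisc, vanishes at `0` and has vanishing Fréchet derivative there
(`prop4_flat_Ck_ins`), i.e. its power series at `0` has `p₀ = p₁ = 0` (`prop4_flat_Ck_powerSeries`) — the homogeneous
polynomials `C_k^{(n)}`, `n ≥ 2`, are the terms `p_n(A, …, A)` and receive no separate names or bounds here.  (c) SETTING: `ℤ^d` (no torus; every `Ω^{(j)}` identified with `ℤ^d` by rescaling, as in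
`B7Prop2Explicit`), a complete normed `ℂ`-algebra `𝔸`, `B_b ∈ 𝔸` arbitrary with a GLOBAL bound `sup_b ‖B_b‖ ≤ b`
(print: `|A| < α₁` on `Ω`; the `i`, `η` absorbed: `b` plays `ηα₁`, `L^kb` plays `L^kηα₁ = α₁` at `L^kη = 1`); the
printed strict `<` become `≤`.  (d) CONSTANTS: `C₂ = 8C₁ = 10048(d+1)²` is print's (133) `C₂ = e^{O(1)2α₀}8C₁` at
`α₀ = 0` with the tree's witness `C₁(d) = 1256(d+1)²`; `c₄ = 1/(8C₁(d))` depends on `d` only (print: "c₄ depends on d and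
L" — print imposes `α₁ ≤ ½c₃(d, L)`; here the level-`j` condition `2L^jb ≤ c₃(d, L)`, `j < k`, is derived from
`L^{j+1}b ≤ L^kb ≤ c₄(d)`, using one factor `L` of the scale ratio, so no `L`-dependence remains); `L ≥ 2` is used
(print: `L` a large integer).  (e) NORMALISATION: the file's `linQIter` is the un-normalised linear part `L^jη·Q_j(U₀)A`
of (130) (as `linQ = L·Q₀` in `B7Prop3Flat`), so (130)'s left side `|(1/(L^jη))Q_j − Q_jA|` appears multiplied by `L^jη`.

FINDINGS (cell GAPS.md C-b07g17-1).  At `U₀ = 1` the induction (128)–(133) is correct as printed, with `C₂ = 8C₁`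
exactly as (133) states at `α₀ = 0`, uniformly in `k`; the printed identification of the composed linear parts with
B5's `Q_k` ("easily seen", B5 p. 20; B7 p. 39) is kernel-checked (`linQ_comp`).  No gap located.  VALUE = first
kernel-certified piece of Prop. 4 for the paper's own objects, incl. (161) `|(1/i) log U̿′^j| < 2α₁L^jη` used in Sect. E;
NOT summit progress (the curved background `U₀ ≠ 1` and papers B8–B13 remain; at `U₀ = 1` every clause of Prop. 4,
(136) included, is kernel-checked in the senses recorded under DIVERGENCES (b)–(e)).

VERSIONS.  v1 (gen 17, p188562): §1–§2.  v1.1 (gen 17, same seat): §3 ANALYTICITY appended (`two_mul_le_c3_of_small`,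
`prop4_flat_analyticAt`, `logIter_zero_field`, `linQIter_csmul`, `linQIter_zero_field`, `analyticAt_linQIter`,
`c4_div_pow_pos`, `smallness_of_le_c4_div`, `prop4_flat_analyticOnNhd_ins`, `isOpen_polydisc`,
`prop4_flat_analyticOnNhd_mlog_ins`, `prop4_flat_ins`, `hasDerivAt_logIter_ins_dir`, `hasFDerivAt_logIter_ins`,
`hasFDerivAt_linQIter_ins`, `prop4_flat_Ck_ins`, `prop4_flat_Ck_powerSeries`); module docstring: title, DICTIONARY,
contents, ABSOLUTE-RULE LEDGER, DIVERGENCES (b), FINDINGS updated, THE PRINTED TEXT += (137); the docstring of `prop4_flat`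
points to §3; every v1 declaration otherwise byte-identical; imports unchanged.
-/

noncomputable section

open scoped BigOperators
open NormedSpace Finset

namespace Literature.MathematicalPhysics.QuantumFieldTheory.Balaban1983to89.B7Prop4Flat

open B7Prop1Explicit B7Prop2Explicit B7Prop3Flat MatrixLog

-- `Site` alone would resolve to the torus sites of `Setup.lean`; re-export the `ℤ^d` sites of `B7Prop1Explicit`.
export B7Prop1Explicit (Site)

variable {d : ℕ}

/-! ## §1 The straight-line average: composition = coarser block (B5 (1.16)–(1.18), B7 p. 39) -/

section Algebra

variable {𝔸 : Type*} [NormedRing 𝔸] [NormedAlgebra ℂ 𝔸]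

/-- Mixed-radix pairing of block offsets: `(r, r′) ↦ r″`, `r″_μ = r′_μ + M·r_μ`, a bijection
`[0, L)^d × [0, M)^d ≃ [0, LM)^d` (the block `B^{j+1}` as `L^d` translates of blocks `B^j`). [folklore] -/
def boxPair (L M : ℕ) : (Fin d → Fin L) × (Fin d → Fin M) ≃ (Fin d → Fin (L * M)) :=
  ((Equiv.arrowProdEquivProdArrow _ _ _).symm).trans (Equiv.piCongrRight fun _ => finProdFinEquiv)

/-- `boxPair_apply_val`: the coordinates of the paired offset. [folklore] -/
theorem boxPair_apply_val (L M : ℕ) (r : Fin d → Fin L) (r' : Fin d → Fin M) (μ : Fin d) :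
    ((boxPair L M (r, r') μ : Fin (L * M)) : ℕ) = r' μ + M * r μ := by
  simp [boxPair, finProdFinEquiv]

/-- `boxVec_boxPair`: as lattice vectors, `r″ = M·r + r′`. [folklore] -/
theorem boxVec_boxPair (L M : ℕ) (r : Fin d → Fin L) (r' : Fin d → Fin M) :
    boxVec (L * M) (boxPair L M (r, r')) = (M : ℤ) • boxVec L r + boxVec M r' := by
  ext μ
  simp only [boxVec, boxPair_apply_val, Pi.add_apply, Pi.smul_apply, smul_eq_mul]
  push_cast; ring

/-- `L·(Q₀B)_c` as a double finite sum: `Σ_{r∈[0,N)^d} N^{−d} Σ_{i<N} B(p + r + ie_κ, κ)` (B5 (1.11) un-normalised: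
straight segments `[x, x + Ne_κ]`, `x ∈ B(c₋)`). [cite: Balaban1984PropagatorsI, (1.11) p.19] -/
theorem linQ_eq_sum (N : ℕ) (B : Site d → Fin d → 𝔸) (p : Site d) (κ : Fin d) :
    linQ N B p κ =
      ∑ r : Fin d → Fin N, (((N : ℝ) ^ d)⁻¹) • ∑ i : Fin N, B (p + boxVec N r + ((i : ℕ) : ℤ) • e κ) κ := by
  simp only [linQ, asum_seg_natCast, ← Fin.sum_univ_eq_sum_range]

/-- **Composition of straight-line averages** — B5 p. 20: "Q₂ is defined as Q only with the number L replaced by L² in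
all definitions. It is easily seen that a composition of k transformations is given by (1.17) where (Q_kA)_b =
Σ_{x∈B^k(b₋)} η^{d+1} A([x, x(b)])" (1.18); B7 p. 39: "A composition of k operators Q is the operator Q_k."  PROVED for
arbitrary block sizes: averaging with block `L` the field `z ↦ (M`-block average of `B` at `Mz)` gives the `LM`-block
average of `B` (un-normalised forms; the box `[0, LM)^d` and the segment `[0, LM)` split in mixed radix).
[cite: Balaban1984PropagatorsI, (1.16)–(1.18) p.20; Balaban1985Averaging, p.39] -/
theorem linQ_comp (L M : ℕ) (B : Site d → Fin d → 𝔸) (q : Site d) (κ : Fin d) :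
    linQ L (fun z κ' => linQ M B ((M : ℤ) • z) κ') q κ = linQ (L * M) B ((M : ℤ) • q) κ := by
  simp only [linQ_eq_sum, Finset.smul_sum, smul_smul]
  rw [← (boxPair L M).sum_comp, Fintype.sum_prod_type]
  refine Finset.sum_congr rfl fun r _ => ?_
  conv_lhs => rw [Finset.sum_comm]
  refine Finset.sum_congr rfl fun r' _ => ?_
  rw [← (finProdFinEquiv (m := L) (n := M)).sum_comp, Fintype.sum_prod_type]
  refine Finset.sum_congr rfl fun i _ => Finset.sum_congr rfl fun i' _ => ?_
  have hw : ((L : ℝ) ^ d)⁻¹ * ((M : ℝ) ^ d)⁻¹ = (((L * M : ℕ) : ℝ) ^ d)⁻¹ := by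
    rw [Nat.cast_mul, mul_pow, mul_inv]
  have harg : (M : ℤ) • (q + boxVec L r + ((i : ℕ) : ℤ) • e κ) + boxVec M r' + ((i' : ℕ) : ℤ) • e κ
      = (M : ℤ) • q + boxVec (L * M) (boxPair L M (r, r')) + ((finProdFinEquiv (i, i') : ℕ) : ℤ) • e κ := by
    rw [boxVec_boxPair]
    ext μ
    simp only [finProdFinEquiv_apply_val, Pi.add_apply, Pi.smul_apply, smul_eq_mul, boxVec, e_apply]
    push_cast
    split_ifs <;> ring
  rw [hw, harg]

/-- **`Q_j(U₀)` at `U₀ = 1`, the composition of the linear parts of the first `j` functions (127)** — p. 38: "denoting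
… Q_{j+1}(U₀) = Q(Ū₀^j)Q_j(U₀)", at `U₀ = 1` where every `Q(Ū₀^j) = Q₀` (125) — in the un-normalised form `L^jη·Q_j(1)A`
of (130) and read on the unit lattice after `j` rescalings: `linQIter L B 0 = B`,
`linQIter L B (j+1) (z, κ) = L·(Q₀ (linQIter L B j))` at the `L`-bond `⟨Lz, Lz + Le_κ⟩`. [cite: Balaban1985Averaging, (127) p.37, p.38 (before (133)), (125) p.36] -/
def linQIter (L : ℕ) (B : Site d → Fin d → 𝔸) : ℕ → Site d → Fin d → 𝔸
  | 0 => B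
  | j + 1 => fun z κ => linQ L (linQIter L B j) ((L : ℤ) • z) κ

/-- `linQIter_zero`: `Q₀(U₀)` composed zero times is the identity. [cite: Balaban1985Averaging, (127) p.37] -/
@[simp] theorem linQIter_zero (L : ℕ) (B : Site d → Fin d → 𝔸) : linQIter L B 0 = B := rfl

/-- `linQIter_succ`: "Q_{j+1}(U₀) = Q(Ū₀^j)Q_j(U₀)" at `U₀ = 1`. [cite: Balaban1985Averaging, p.38 (before (133))] -/
theorem linQIter_succ (L : ℕ) (B : Site d → Fin d → 𝔸) (j : ℕ) (z : Site d) (κ : Fin d) :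
    linQIter L B (j + 1) z κ = linQ L (linQIter L B j) ((L : ℤ) • z) κ := rfl

/-- The one-block average is the identity: `linQ 1 B = B` (block `[0, 1)^d = {0}`, segment of one bond). [folklore] -/
theorem linQ_one (B : Site d → Fin d → 𝔸) (p : Site d) (κ : Fin d) : linQ 1 B p κ = B p κ := by
  rw [linQ_eq_sum, Fintype.sum_unique, Fin.sum_univ_one]
  have h0 : ∀ r : Fin d → Fin 1, boxVec 1 r = 0 := fun r => funext fun μ => by simp [boxVec]
  simp [h0]

/-- **"A composition of k operators Q is the operator Q_k"** (B7 p. 39; B5 (1.18)) at `U₀ = 1`, PROVED: the `j`-fold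
composed linear part equals the straight-line average over `L^j`-blocks, `linQIter L B j (z, κ) =
Σ_{x∈B^j(c₋)} L^{−jd} B([x, x + L^je_κ])` for the `L^j`-bond `c = ⟨L^jz, L^jz + L^je_κ⟩` of `ℤ^d`.
[cite: Balaban1985Averaging, p.39; Balaban1984PropagatorsI, (1.18) p.20] -/
theorem linQIter_eq_linQ_pow (L : ℕ) (B : Site d → Fin d → 𝔸) :
    ∀ (j : ℕ) (z : Site d) (κ : Fin d), linQIter L B j z κ = linQ (L ^ j) B (((L ^ j : ℕ) : ℤ) • z) κ
  | 0, z, κ => by simp [linQ_one]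
  | j + 1, z, κ => by
    have hfun : linQIter L B j = fun z' κ' => linQ (L ^ j) B (((L ^ j : ℕ) : ℤ) • z') κ' :=
      funext fun z' => funext fun κ' => linQIter_eq_linQ_pow L B j z' κ'
    rw [linQIter_succ, hfun, linQ_comp, smul_smul, pow_succ']
    congr 1
    push_cast
    ring_nf

omit [NormedAlgebra ℂ 𝔸] in
/-- `stepA_sub`: the path functional is linear in the field — bookkeeping. [folklore] -/
theorem stepA_sub (F G : Site d → Fin d → 𝔸) (x : Site d) (l : Letter d) :
    stepA (F - G) x l = stepA F x l - stepA G x l := by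
  unfold stepA
  split_ifs
  · rfl
  · rw [Pi.sub_apply, Pi.sub_apply, neg_sub', sub_eq_add_neg]

omit [NormedAlgebra ℂ 𝔸] in
/-- `asum_sub`: `(F − G)(Γ) = F(Γ) − G(Γ)`. [folklore] -/
theorem asum_sub (F G : Site d → Fin d → 𝔸) :
    ∀ (x : Site d) (w : List (Letter d)), asum (F - G) x w = asum F x w - asum G x w
  | x, [] => by simp
  | x, l :: w => by
    rw [asum_cons, asum_cons, asum_cons, stepA_sub, asum_sub F G (x + l.vec) w]
    abel

/-- `linQ_sub`: the straight-line average is linear. [folklore] -/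
theorem linQ_sub (L : ℕ) (F G : Site d → Fin d → 𝔸) (q : Site d) (κ : Fin d) :
    linQ L (F - G) q κ = linQ L F q κ - linQ L G q κ := by
  simp only [linQ, asum_sub, smul_sub, Finset.sum_sub_distrib]

/-- (125)–(126) with a global bound: `sup_b |F_b| ≤ m` ⟹ `|L·(Q₀F)_c| ≤ L·m` at every `c` (`B7Prop3Flat.norm_linQ_le`
with the region all of `ℤ^d`). [cite: Balaban1985Averaging, (125)–(126) p.36] -/
theorem norm_linQ_le_of_bound (F : Site d → Fin d → 𝔸) {m : ℝ} (hm : 0 ≤ m) (hF : ∀ x κ, ‖F x κ‖ ≤ m)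
    (L : ℕ) (hL : 1 ≤ L) (q : Site d) (κ : Fin d) : ‖linQ L F q κ‖ ≤ L * m :=
  norm_linQ_le F q (d * L + L) hm (fun x κ _ => hF x κ) L hL q κ (by simp [l1])

/-- `|L^jη·(Q_j(1)A)| ≤ L^jη·|A|` — (126) iterated: the composed linear part of a field with `sup_b |B_b| ≤ b` is bounded
by `L^j·b`. [cite: Balaban1985Averaging, (126) p.36, (131) p.38] -/
theorem norm_linQIter_le (L : ℕ) (hL : 1 ≤ L) (B : Site d → Fin d → 𝔸) {b : ℝ} (hb : 0 ≤ b)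
    (hB : ∀ x κ, ‖B x κ‖ ≤ b) :
    ∀ (j : ℕ) (z : Site d) (κ : Fin d), ‖linQIter L B j z κ‖ ≤ (L : ℝ) ^ j * b
  | 0, z, κ => by simpa using hB z κ
  | j + 1, z, κ => by
    have ih : ∀ z κ, ‖linQIter L B j z κ‖ ≤ (L : ℝ) ^ j * b := norm_linQIter_le L hL B hb hB j
    calc ‖linQIter L B (j + 1) z κ‖ = ‖linQ L (linQIter L B j) ((L : ℤ) • z) κ‖ := by rw [linQIter_succ]
      _ ≤ L * ((L : ℝ) ^ j * b) := norm_linQ_le_of_bound _ (by positivity) ih L hL _ κ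
      _ = (L : ℝ) ^ (j + 1) * b := by ring

end Algebra

/-! ## §2 The `k`-th order double-bar average (90)/(91) at `U₀ = 1` and its logarithm -/

section Iterate

variable {𝔸 : Type*} [NormedRing 𝔸] [NormedAlgebra ℂ 𝔸] [CompleteSpace 𝔸]

/-- **(90)/(91) at `U₀ = 1`**: "U̿₁ = \overline{R(U₀)U₁}", "U̿₁^{j+1} = \overline{R(Ū₀^j)U̿₁^j}, i.e., it is a composition of
the operation (89) for V₀ = Ū₀^j and of the j-th order operation U̿₁^j" — with `U₀ = 1` all `Ū₀^j = 1`, so `U̿₁^{j+1}` is the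
one-step double-bar average (89)|_{V₀=1} (`B7Prop3Flat.dbavg`) of `U̿₁^j`, read on the unit lattice (`rescale`, the
identification `Ω^{(j)} ≅ ℤ^d` of `B7Prop2Explicit`): `dbavgIter L V 0 = V`, `dbavgIter L V (j+1) = rescale L (dbavg L
(dbavgIter L V j))`. [cite: Balaban1985Averaging, (90)–(91) p.31, (127) p.37] -/
def dbavgIter (L : ℕ) (V : Site d → Fin d → 𝔸ˣ) : ℕ → Site d → Fin d → 𝔸ˣ
  | 0 => V
  | j + 1 => rescale L (dbavg L (dbavgIter L V j))

/-- `dbavgIter_zero`: `U̿₁^0 = U₁`. [cite: Balaban1985Averaging, (90) p.31] -/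
@[simp] theorem dbavgIter_zero (L : ℕ) (V : Site d → Fin d → 𝔸ˣ) : dbavgIter L V 0 = V := rfl

/-- `dbavgIter_succ`: (91) at `U₀ = 1`, bondwise. [cite: Balaban1985Averaging, (91) p.31] -/
theorem dbavgIter_succ (L : ℕ) (V : Site d → Fin d → 𝔸ˣ) (j : ℕ) (z : Site d) (κ : Fin d) :
    dbavgIter L V (j + 1) z κ = dbavg L (dbavgIter L V j) ((L : ℤ) • z) κ := rfl

/-- **`Q_j(U₀, ηA)` at `U₀ = 1`, the composition of the first `j` functions (127)** — "Q_{j+1}(U₀, ηA) =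
Q(Ū₀^j, Q_j(U₀, ηA))" (p. 38), each factor being `A ↦ Q(1, A) = (1/i) log V̿₁[e^{A}]` (121): `logIter L B 0 = B`,
`logIter L B (j+1) (z, κ) = log (dbavg L (e^{logIter L B j}) (Lz, κ))` (`log` = the series (21)).  Under the smallness of
Prop. 4 this IS `(1/i) log U̿₁^j` (`mlog_dbavgIter`). [cite: Balaban1985Averaging, (127) p.37, p.38 (before (133)), (121) p.36] -/
def logIter (L : ℕ) (B : Site d → Fin d → 𝔸) : ℕ → Site d → Fin d → 𝔸
  | 0 => B
  | j + 1 => fun z κ => mlog ((dbavg L (expCfg (logIter L B j)) ((L : ℤ) • z) κ : 𝔸ˣ) : 𝔸)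

/-- `logIter_zero`. [cite: Balaban1985Averaging, (127) p.37] -/
@[simp] theorem logIter_zero (L : ℕ) (B : Site d → Fin d → 𝔸) : logIter L B 0 = B := rfl

/-- `logIter_succ`: "Q_{j+1}(U₀, ηA) = Q(Ū₀^j, Q_j(U₀, ηA))" at `U₀ = 1`. [cite: Balaban1985Averaging, p.38 (before (133))] -/
theorem logIter_succ (L : ℕ) (B : Site d → Fin d → 𝔸) (j : ℕ) (z : Site d) (κ : Fin d) :
    logIter L B (j + 1) z κ = mlog ((dbavg L (expCfg (logIter L B j)) ((L : ℤ) • z) κ : 𝔸ˣ) : 𝔸) := rfl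

/-- The witness for the printed `C₂` of (133)/(135) at `U₀ = 1`: `C₂(d) = 8C₁(d) = 10048(d+1)²` ("C₂ = e^{O(1)2α₀}8C₁",
`α₀ = 0`; "C₂ depends on d"). [cite: Balaban1985Averaging, (133) p.38, Prop. 4 p.39] -/
def C2 (d : ℕ) : ℝ := 8 * C1 d

/-- The witness for the printed threshold `c₄` of Prop. 4 at `U₀ = 1` (a condition on `α₁` only, `α₀ = 0`):
`c₄(d) = 1/(8C₁(d))`, i.e. "8C₁α₁ ≤ …" of (129)/(131). [cite: Balaban1985Averaging, (129) p.37, (131) p.38, Prop. 4 p.39] -/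
def c4 (d : ℕ) : ℝ := 1 / (8 * C1 d)

/-- `C1_pos`: `C₁(d) > 0`. [folklore] -/
theorem C1_pos (d : ℕ) : 0 < C1 d := by unfold C1; positivity

/-- `e^{log W} = W` in `𝔸ˣ` for `|W − 1| < 1` (the series (21)/(22)). [cite: Balaban1985Averaging, (21)–(22) p.21] -/
theorem expUnit_mlog {W : 𝔸ˣ} (hW : ‖(W : 𝔸) - 1‖ < 1) : expUnit (mlog (W : 𝔸)) = W :=
  Units.ext (by rw [val_expUnit, exp_mlog hW])

/-- **Prop. 3 at `V₀ = 1` in global form** (from `B7Prop3Flat.prop3_flat`): a bond field with `sup_b ‖F_b‖ ≤ a ≤ c₃(d, L)`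
has, at EVERY `L`-bond `c = ⟨q, q + Le_κ⟩`, `‖(1/i) log V̿₁(c)[e^{F}] − L·(Q₀F)_c‖ ≤ C₁(d)L²a²` ((122)–(123)) and
`‖V̿₁(c) − 1‖ < 1` (so `V̿₁(c) = exp((1/i) log V̿₁(c))`). [cite: Balaban1985Averaging, Prop. 3 (122)–(123) p.36, (120) p.35] -/
theorem prop3_flat_global (F : Site d → Fin d → 𝔸) {a : ℝ} (ha : 0 ≤ a) (hF : ∀ x κ, ‖F x κ‖ ≤ a)
    (L : ℕ) (hL : 1 ≤ L) (hac : a ≤ c3 d L) (q : Site d) (κ : Fin d) :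
    ‖mlog ((dbavg L (expCfg F) q κ : 𝔸ˣ) : 𝔸) - linQ L F q κ‖ ≤ C1 d * (L : ℝ) ^ 2 * a ^ 2 ∧
      ‖((dbavg L (expCfg F) q κ : 𝔸ˣ) : 𝔸) - 1‖ < 1 := by
  have hVA : ∀ x κ', l1 (x - q) ≤ 2 * (d * L) + L + L →
      (((expCfg F) x κ' : 𝔸ˣ) : 𝔸) = exp (F x κ') ∧ ‖F x κ'‖ ≤ a := fun x κ' _ => ⟨rfl, hF x κ'⟩
  refine ⟨?_, (logDomain_of_le_c3 (expCfg F) F q (2 * (d * L) + L + L) ha hVA L hL q κ (by simp [l1]) hac).2.2.2⟩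
  have h := (prop3_flat (expCfg F) F q (2 * (d * L) + L + L) ha hVA L hL q κ (by simp [l1]) hac).1
  rwa [← linQ_eq_smul_Q0form L hL] at h

/-- **The induction (128)–(132) at `U₀ = 1`, PROVED**: for `L ≥ 2`, a bond field with `sup_b ‖B_b‖ ≤ b` and
`8C₁(d)·L^k·b ≤ 1`, and every `j ≤ k`: (i) `U̿₁^j = exp Q_j` bondwise — `dbavgIter L (e^B) j = e^{logIter L B j}`;
(ii) (130): `‖Q_j − L^jη·Q_j(1)A‖ ≤ 8C₁(L^jb)²` (print: `< 4C₁(L^j + … + L)ηα₁²`, times `L^jη`, `≤ 8C₁(L^jηα₁)²`);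
(iii) (131) = (161): `‖Q_j‖ ≤ 2L^jb` ("< 2α₁L^jη").  Step: Prop. 3 at `V₀ = 1` applied to `Q_j` with `a = 2L^jb ≤
c₃(d, L)` ("for α₁ ≤ ½c₃ we can apply Proposition 3 … calculated at Q_j(U₀, ηA)"), linearity of `Q₀` and
`L·8C₁t² + 4C₁(Lt)² ≤ 8C₁(Lt)²` for `L ≥ 2`. [cite: Balaban1985Averaging, (128)–(132) pp.37–38, (161) p.42] -/
theorem prop4_flat_induction (L : ℕ) (hL : 2 ≤ L) (B : Site d → Fin d → 𝔸) {b : ℝ} (hb : 0 ≤ b)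
    (hB : ∀ x κ, ‖B x κ‖ ≤ b) (k : ℕ) (hk : 8 * C1 d * ((L : ℝ) ^ k * b) ≤ 1) :
    ∀ j ≤ k, dbavgIter L (expCfg B) j = expCfg (logIter L B j) ∧
      (∀ z κ, ‖logIter L B j z κ - linQIter L B j z κ‖ ≤ 8 * C1 d * ((L : ℝ) ^ j * b) ^ 2) ∧
      (∀ z κ, ‖logIter L B j z κ‖ ≤ 2 * ((L : ℝ) ^ j * b)) := by
  have hL1 : 1 ≤ L := le_trans (by norm_num) hL
  have hLr : (2 : ℝ) ≤ L := by exact_mod_cast hL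
  have hC1 := C1_pos d
  have ht_mono : ∀ {j : ℕ}, j ≤ k → (L : ℝ) ^ j * b ≤ (L : ℝ) ^ k * b := fun hj =>
    mul_le_mul_of_nonneg_right (pow_le_pow_right₀ (by exact_mod_cast hL1) hj) hb
  intro j
  induction j with
  | zero =>
    intro _
    refine ⟨rfl, fun z κ => ?_, fun z κ => ?_⟩
    · rw [logIter_zero, linQIter_zero, sub_self, norm_zero]
      exact mul_nonneg (mul_nonneg (by norm_num) hC1.le) (sq_nonneg _)
    · rw [logIter_zero, pow_zero, one_mul]
      linarith [hB z κ]
  | succ j ih =>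
    intro hjk
    obtain ⟨hX, hE, hA⟩ := ih (Nat.le_of_succ_le hjk)
    set t : ℝ := (L : ℝ) ^ j * b with ht
    have ht0 : 0 ≤ t := by positivity
    have htL : (L : ℝ) ^ (j + 1) * b = L * t := by rw [ht, pow_succ]; ring
    have hLt0 : 0 ≤ (L : ℝ) * t := by positivity
    -- 8 C₁ t_{j+1} ≤ 8 C₁ t_k ≤ 1
    have ht1 : 8 * C1 d * (L * t) ≤ 1 := by
      rw [← htL]
      exact (mul_le_mul_of_nonneg_left (ht_mono hjk) (by positivity)).trans hk
    -- applicability of Prop. 3 at level j: a = 2 t_j ≤ c₃(d, L), from 256(d+1)·L t_j ≤ 8C₁·L t_j ≤ 1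
    have hd1 : (1 : ℝ) ≤ (d : ℝ) + 1 := by
      have : (0 : ℝ) ≤ d := Nat.cast_nonneg d
      linarith
    have hac : 2 * t ≤ c3 d L := by
      have hpos : (0 : ℝ) < 128 * ((d : ℝ) + 1) * L := by positivity
      rw [c3, le_div_iff₀ hpos]
      have h256 : 2 * t * (128 * ((d : ℝ) + 1) * L) = 256 * ((d : ℝ) + 1) * (L * t) := by ring
      have hle : 256 * ((d : ℝ) + 1) ≤ 8 * C1 d := by unfold C1; nlinarith [hd1]
      rw [h256]
      exact (mul_le_mul_of_nonneg_right hle hLt0).trans ht1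
    -- Prop. 3 at V₀ = 1 applied to Q_j at the L-bond based at Lz
    have hstep : ∀ z κ,
        ‖mlog ((dbavg L (expCfg (logIter L B j)) ((L : ℤ) • z) κ : 𝔸ˣ) : 𝔸)
            - linQ L (logIter L B j) ((L : ℤ) • z) κ‖ ≤ C1 d * (L : ℝ) ^ 2 * (2 * t) ^ 2 ∧
          ‖((dbavg L (expCfg (logIter L B j)) ((L : ℤ) • z) κ : 𝔸ˣ) : 𝔸) - 1‖ < 1 := fun z κ =>
      prop3_flat_global (logIter L B j) (by positivity) hA L hL1 hac ((L : ℤ) • z) κ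
    -- linearity: Q₀ of the error field
    have hlin : ∀ z κ, ‖linQ L (logIter L B j) ((L : ℤ) • z) κ - linQ L (linQIter L B j) ((L : ℤ) • z) κ‖
        ≤ L * (8 * C1 d * t ^ 2) := fun z κ => by
      rw [← linQ_sub]
      exact norm_linQ_le_of_bound (logIter L B j - linQIter L B j) (by positivity)
        (fun x κ' => by rw [Pi.sub_apply, Pi.sub_apply]; exact hE x κ') L hL1 _ κ
    have hkey : C1 d * (L : ℝ) ^ 2 * (2 * t) ^ 2 + L * (8 * C1 d * t ^ 2) ≤ 8 * C1 d * (L * t) ^ 2 := by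
      have hLL : 8 * (L : ℝ) ≤ 4 * (L : ℝ) ^ 2 := by nlinarith [hLr]
      have := mul_le_mul_of_nonneg_right hLL (mul_nonneg hC1.le (sq_nonneg t))
      nlinarith [this]
    refine ⟨?_, ?_, ?_⟩
    · funext z κ
      rw [dbavgIter_succ, hX]
      exact (expUnit_mlog (hstep z κ).2).symm
    · rw [htL]
      intro z κ
      rw [logIter_succ, linQIter_succ]
      calc _ ≤ ‖mlog ((dbavg L (expCfg (logIter L B j)) ((L : ℤ) • z) κ : 𝔸ˣ) : 𝔸)
                - linQ L (logIter L B j) ((L : ℤ) • z) κ‖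
              + ‖linQ L (logIter L B j) ((L : ℤ) • z) κ - linQ L (linQIter L B j) ((L : ℤ) • z) κ‖ :=
            norm_sub_le_norm_sub_add_norm_sub _ _ _
        _ ≤ C1 d * (L : ℝ) ^ 2 * (2 * t) ^ 2 + L * (8 * C1 d * t ^ 2) := add_le_add (hstep z κ).1 (hlin z κ)
        _ ≤ 8 * C1 d * (L * t) ^ 2 := hkey
    · rw [htL]
      intro z κ
      have hlinb : ‖linQIter L B (j + 1) z κ‖ ≤ L * t := by
        have := norm_linQIter_le L hL1 B hb hB (j + 1) z κ
        rwa [htL] at this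
      have herr : ‖logIter L B (j + 1) z κ - linQIter L B (j + 1) z κ‖ ≤ 8 * C1 d * (L * t) ^ 2 := by
        rw [logIter_succ, linQIter_succ]
        calc _ ≤ ‖mlog ((dbavg L (expCfg (logIter L B j)) ((L : ℤ) • z) κ : 𝔸ˣ) : 𝔸)
                  - linQ L (logIter L B j) ((L : ℤ) • z) κ‖
                + ‖linQ L (logIter L B j) ((L : ℤ) • z) κ - linQ L (linQIter L B j) ((L : ℤ) • z) κ‖ :=
              norm_sub_le_norm_sub_add_norm_sub _ _ _
          _ ≤ C1 d * (L : ℝ) ^ 2 * (2 * t) ^ 2 + L * (8 * C1 d * t ^ 2) := add_le_add (hstep z κ).1 (hlin z κ)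
          _ ≤ 8 * C1 d * (L * t) ^ 2 := hkey
      have hsq : 8 * C1 d * (L * t) ^ 2 ≤ L * t := by
        have : 8 * C1 d * (L * t) ^ 2 = (8 * C1 d * (L * t)) * (L * t) := by ring
        rw [this]
        exact (mul_le_mul_of_nonneg_right ht1 hLt0).trans_eq (one_mul _)
      calc ‖logIter L B (j + 1) z κ‖
          ≤ ‖linQIter L B (j + 1) z κ‖ + ‖logIter L B (j + 1) z κ - linQIter L B (j + 1) z κ‖ :=
            norm_le_insert' _ _
        _ ≤ L * t + L * t := add_le_add hlinb (herr.trans hsq)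
        _ = 2 * (L * t) := by ring

/-- Under the smallness of Prop. 4, `U̿₁^j = exp Q_j` bondwise for every `j ≤ k`: the iterate (90)/(91) at `U₀ = 1` of
`U₁ = e^{B}` is `e^{logIter L B j}`. [cite: Balaban1985Averaging, (127) p.37, (161) p.42] -/
theorem dbavgIter_eq_expCfg_logIter (L : ℕ) (hL : 2 ≤ L) (B : Site d → Fin d → 𝔸) {b : ℝ} (hb : 0 ≤ b)
    (hB : ∀ x κ, ‖B x κ‖ ≤ b) (k : ℕ) (hkb : (L : ℝ) ^ k * b ≤ c4 d) {j : ℕ} (hj : j ≤ k) :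
    dbavgIter L (expCfg B) j = expCfg (logIter L B j) := by
  have hC1 := C1_pos d
  have hk : 8 * C1 d * ((L : ℝ) ^ k * b) ≤ 1 := by
    have h := mul_le_mul_of_nonneg_left hkb (by positivity : (0 : ℝ) ≤ 8 * C1 d)
    rwa [c4, mul_one_div_cancel (by positivity)] at h
  exact (prop4_flat_induction L hL B hb hB k hk j hj).1

/-- Under the smallness of Prop. 4, `(1/i) log U̿₁^k = Q_k(1, ηA)` bondwise (`k ≥ 1`): the logarithm (21) of the iterate
(90)/(91) is the composed function (127). [cite: Balaban1985Averaging, (127) p.37, (121) p.36] -/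
theorem mlog_dbavgIter (L : ℕ) (hL : 2 ≤ L) (B : Site d → Fin d → 𝔸) {b : ℝ} (hb : 0 ≤ b)
    (hB : ∀ x κ, ‖B x κ‖ ≤ b) (k : ℕ) (hkb : (L : ℝ) ^ (k + 1) * b ≤ c4 d) (z : Site d) (κ : Fin d) :
    mlog ((dbavgIter L (expCfg B) (k + 1) z κ : 𝔸ˣ) : 𝔸) = logIter L B (k + 1) z κ := by
  rw [dbavgIter_succ, dbavgIter_eq_expCfg_logIter L hL B hb hB (k + 1) hkb (Nat.le_succ k), logIter_succ]

/-- **Proposition 4 of B7 at the flat background `U₀ = 1`, printed shape (134)–(135) with (131) = (161), PROVED for the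
concrete objects (42)/(89)/(90)–(91) on `ℤ^d`, UNIFORMLY IN `k`**: let `L ≥ 2`, `k ≥ 1`, `U₁ = e^{B}` bondwise with
`sup_b ‖B_b‖ ≤ b` and `L^k·b ≤ c₄(d) = 1/(8C₁(d))` (print: `|A| < α₁ ≤ c₄`, `B = iηA`, `L^kη = 1`).  Then at every
`L^k`-bond `c` (base point `L^kz` of `ℤ^d`, direction `κ`): "(134) Q_k(U₀, ηA) = Q_k(U₀)A + C_k(U₀, A)", "(135)
|C_k(U₀, A)| ≤ C₂|A|²" — `‖(1/i) log U̿₁^k(c) − L^kη·(Q_k(1)A)_c‖ ≤ C₂(d)·(L^kb)²`, `C₂(d) = 8C₁(d) = 10048(d+1)²`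
("C₂ … independent of k, C₂ depends on d"); (131)/(161) `‖(1/i) log U̿₁^k(c)‖ ≤ 2L^kb` ("< 2α₁L^kη"); and
`U̿₁^k(c) = exp((1/i) log U̿₁^k(c))`, the logarithm being the series (21) (`‖U̿₁^k(c) − 1‖ < 1`).  The curved background is
NOT treated (header, DIVERGENCES (a)); the analyticity clause and (136) are §3 (v1.1). [cite: Balaban1985Averaging, Prop. 4 (134)–(135) pp.38–39, (131) p.38, (161) p.42] -/
theorem prop4_flat (L : ℕ) (hL : 2 ≤ L) (B : Site d → Fin d → 𝔸) {b : ℝ} (hb : 0 ≤ b)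
    (hB : ∀ x κ, ‖B x κ‖ ≤ b) (k : ℕ) (hk : 1 ≤ k) (hkb : (L : ℝ) ^ k * b ≤ c4 d) (z : Site d) (κ : Fin d) :
    ‖mlog ((dbavgIter L (expCfg B) k z κ : 𝔸ˣ) : 𝔸) - linQIter L B k z κ‖ ≤ C2 d * ((L : ℝ) ^ k * b) ^ 2 ∧
      ‖mlog ((dbavgIter L (expCfg B) k z κ : 𝔸ˣ) : 𝔸)‖ ≤ 2 * ((L : ℝ) ^ k * b) ∧
      ((dbavgIter L (expCfg B) k z κ : 𝔸ˣ) : 𝔸) = exp (mlog ((dbavgIter L (expCfg B) k z κ : 𝔸ˣ) : 𝔸)) := by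
  have hC1 := C1_pos d
  have hk8 : 8 * C1 d * ((L : ℝ) ^ k * b) ≤ 1 := by
    have h := mul_le_mul_of_nonneg_left hkb (by positivity : (0 : ℝ) ≤ 8 * C1 d)
    rwa [c4, mul_one_div_cancel (by positivity)] at h
  obtain ⟨j, rfl⟩ : ∃ j, k = j + 1 := ⟨k - 1, by omega⟩
  obtain ⟨hX, hE, hA⟩ := prop4_flat_induction L hL B hb hB (j + 1) hk8 (j + 1) le_rfl
  have hval : mlog ((dbavgIter L (expCfg B) (j + 1) z κ : 𝔸ˣ) : 𝔸) = logIter L B (j + 1) z κ :=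
    mlog_dbavgIter L hL B hb hB j hkb z κ
  refine ⟨?_, ?_, ?_⟩
  · rw [hval, C2]; exact hE z κ
  · rw [hval]; exact hA z κ
  · rw [hval, hX]; rfl

/-- **Prop. 4 at `U₀ = 1` with the linear part as B5's `Q_k`** (B7 p. 39 "A composition of k operators Q is the operator
Q_k"; B5 (1.18)): `‖(1/i) log U̿₁^k(c) − Σ_{x∈B^k(c₋)} L^{−kd} B([x, x + L^ke_κ])‖ ≤ C₂(d)·(L^kb)²` for the `L^k`-bond
`c = ⟨L^kz, L^kz + L^ke_κ⟩`. [cite: Balaban1985Averaging, Prop. 4 (134)–(135) pp.38–39, p.39; Balaban1984PropagatorsI, (1.18) p.20] -/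
theorem prop4_flat_linQ_pow (L : ℕ) (hL : 2 ≤ L) (B : Site d → Fin d → 𝔸) {b : ℝ} (hb : 0 ≤ b)
    (hB : ∀ x κ, ‖B x κ‖ ≤ b) (k : ℕ) (hk : 1 ≤ k) (hkb : (L : ℝ) ^ k * b ≤ c4 d) (z : Site d) (κ : Fin d) :
    ‖mlog ((dbavgIter L (expCfg B) k z κ : 𝔸ˣ) : 𝔸) - linQ (L ^ k) B (((L ^ k : ℕ) : ℤ) • z) κ‖
      ≤ C2 d * ((L : ℝ) ^ k * b) ^ 2 := by
  rw [← linQIter_eq_linQ_pow]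
  exact (prop4_flat L hL B hb hB k hk hkb z κ).1

end Iterate

/-! ## §3 (v1.1) Analyticity of `Q_k(1, ·)`: Prop. 4's "is an analytic function of the variables `A_b`", (134) with
`Q_k(U₀)A` the linear part (Fréchet derivative at `A = 0`), and (136), AT `U₀ = 1`

(127): `Q_k(1, ·)` is the `k`-fold composite of the one-step map `A ↦ Q(1, A)` of Prop. 3, each factor analytic on
`|A| ≤ c₃` (`B7Prop3Flat` §5, `prop3_flat_analyticAt`, parametrised by any complex normed space); the inductive bound
(131) `|Q_j| < 2α₁L^jη ≤ c₃` (`prop4_flat_induction` (iii)) keeps every intermediate field inside that domain, so the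
composite is analytic — print: "for `α₁ ≤ ½c₃` we can apply Proposition 3 to the function `Q(Ū₀^j, ·)` calculated at
`Q_j(U₀, ηA)`" (p. 38).  On the finite products `𝔸^S` (`B7Prop3Flat.insCfg`) this is the printed clause; the Fréchet
derivative at `A = 0` is identified with the composed linear part `L^kη·Q_k(1)A` along complex lines from the quadratic
bound (130)/(135), which gives (134) with `C_k` of second order, i.e. (136). -/

section AnalyticK

variable {𝔸 : Type*} [NormedRing 𝔸] [NormedAlgebra ℂ 𝔸] [CompleteSpace 𝔸]
variable {E : Type*} [NormedAddCommGroup E] [NormedSpace ℂ E]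

/-- APPLICABILITY OF PROP. 3 AT LEVEL `j < k` (p. 38: "and for `α₁ ≤ ½c₃` we can apply Proposition 3 to the function
`Q(Ū₀^j, ·)` calculated at `Q_j(U₀, ηA)`"): if `8C₁(d)·(Lt) ≤ 1` then `2t ≤ c₃(d, L) = 1/(128(d+1)L)`, because
`256(d+1)·Lt ≤ 8C₁(d)·Lt` (`C₁(d) = 1256(d+1)²`; v1 proves this inline in `prop4_flat_induction`).
[cite: Balaban1985Averaging, p.38 (after (131)), (126) p.36] -/
theorem two_mul_le_c3_of_small (L : ℕ) (hL : 1 ≤ L) {t : ℝ} (ht0 : 0 ≤ t)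
    (ht1 : 8 * C1 d * ((L : ℝ) * t) ≤ 1) : 2 * t ≤ c3 d L := by
  have hL0 : 0 < L := hL
  have hLt0 : 0 ≤ (L : ℝ) * t := by positivity
  have hd1 : (1 : ℝ) ≤ (d : ℝ) + 1 := by
    have : (0 : ℝ) ≤ d := Nat.cast_nonneg d
    linarith
  have hpos : (0 : ℝ) < 128 * ((d : ℝ) + 1) * L := by positivity
  rw [c3, le_div_iff₀ hpos]
  have h256 : 2 * t * (128 * ((d : ℝ) + 1) * L) = 256 * ((d : ℝ) + 1) * (L * t) := by ring
  have hle : 256 * ((d : ℝ) + 1) ≤ 8 * C1 d := by unfold C1; nlinarith [hd1]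
  rw [h256]
  exact (mul_le_mul_of_nonneg_right hle hLt0).trans ht1

/-- **Prop. 4 at `U₀ = 1` — ANALYTICITY OF EVERY COMPOSITE `Q_j(1, ·)`, `j ≤ k`, PROVED** (parametrised form, as
`B7Prop3Flat.prop3_flat_analyticAt`): let the initial bond field depend on a parameter `t` ranging over a complex normed
space `E`, `U₁ = e^{B(t)}`, with every bond variable `t ↦ B(t)_b` analytic at `t₀`, `sup_b ‖B(t₀)_b‖ ≤ b` and
`8C₁(d)·L^k·b ≤ 1`, `L ≥ 2`.  Then for every `j ≤ k` and every `L^j`-bond `c` (base point `L^jz`, direction `κ`) the map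
`t ↦ Q_j(1, B(t))(c)` = `logIter L (B t) j z κ` is analytic at `t₀`.  This is (127) "(1/i) log U̿₁^k as a function of
(1/i) log U₁ is a composition of the functions Q(U₀, ·), Q(Ū₀, ·), …, Q(Ū₀^{k−1}, ·)" with every factor analytic by
Prop. 3 at `V₀ = 1` on the domain supplied by (131): `‖Q_j‖ ≤ 2L^jb ≤ c₃(d, L)` (`prop4_flat_induction` (iii),
`two_mul_le_c3_of_small`). [cite: Balaban1985Averaging, Prop. 4 p.38, (127) p.37, (131) p.38, Prop. 3 p.36] -/
theorem prop4_flat_analyticAt (L : ℕ) (hL : 2 ≤ L) (B : E → Site d → Fin d → 𝔸) {t₀ : E}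
    (hBa : ∀ x κ, AnalyticAt ℂ (fun t => B t x κ) t₀) {b : ℝ} (hb : 0 ≤ b) (hB : ∀ x κ, ‖B t₀ x κ‖ ≤ b)
    (k : ℕ) (hk : 8 * C1 d * ((L : ℝ) ^ k * b) ≤ 1) :
    ∀ j ≤ k, ∀ z κ, AnalyticAt ℂ (fun t => logIter L (B t) j z κ) t₀ := by
  have hL1 : 1 ≤ L := le_trans (by norm_num) hL
  have hC1 := C1_pos d
  have ht_mono : ∀ {j : ℕ}, j ≤ k → (L : ℝ) ^ j * b ≤ (L : ℝ) ^ k * b := fun hj =>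
    mul_le_mul_of_nonneg_right (pow_le_pow_right₀ (by exact_mod_cast hL1) hj) hb
  intro j
  induction j with
  | zero => intro _ z κ; exact hBa z κ
  | succ j ih =>
    intro hjk z κ
    have hj : j ≤ k := Nat.le_of_succ_le hjk
    set t : ℝ := (L : ℝ) ^ j * b with ht
    have ht0 : 0 ≤ t := by positivity
    have ht1 : 8 * C1 d * ((L : ℝ) * t) ≤ 1 := by
      have hLt : (L : ℝ) * t = (L : ℝ) ^ (j + 1) * b := by rw [ht, pow_succ]; ring
      rw [hLt]
      exact (mul_le_mul_of_nonneg_left (ht_mono hjk) (by positivity)).trans hk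
    have hac : 2 * t ≤ c3 d L := two_mul_le_c3_of_small L hL1 ht0 ht1
    have hA : ∀ x κ', ‖logIter L (B t₀) j x κ'‖ ≤ 2 * t :=
      (prop4_flat_induction L hL (B t₀) hb hB k hk j hj).2.2
    have h := prop3_flat_analyticAt (fun t => logIter L (B t) j) (fun x κ' => ih hj x κ') ((L : ℤ) • z)
      (2 * (d * L) + L + L) (by positivity) (fun x κ' _ => hA x κ') L hL1 ((L : ℤ) • z) κ (by simp [l1]) hac
    simpa only [logIter_succ] using h

/-- `Q_j(1, 0) = 0`: at `A = 0` (`U₁ = 1`) every iterate is the unit configuration and its logarithm vanishes (one step: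
`B7Prop3Flat.mlog_dbavg_zero`; p. 36 "its Taylor expansion begins with a first-order polynomial").
[cite: Balaban1985Averaging, p.36 (after (121)), (127) p.37] -/
theorem logIter_zero_field (L : ℕ) (hL : 1 ≤ L) : ∀ j : ℕ, logIter L (0 : Site d → Fin d → 𝔸) j = 0
  | 0 => rfl
  | j + 1 => by
    funext z κ
    rw [logIter_succ, logIter_zero_field L hL j]
    exact mlog_dbavg_zero L hL _ κ

omit [CompleteSpace 𝔸] in
/-- The composed linear part `L^jη·Q_j(1)A` is `ℂ`-homogeneous in `A` (a composite of the `ℂ`-linear maps `L·Q₀` (125),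
`B7Prop3Flat.linQ_csmul`). [cite: Balaban1985Averaging, (125) p.36, p.38 (before (130))] -/
theorem linQIter_csmul (L : ℕ) (c : ℂ) (A : Site d → Fin d → 𝔸) :
    ∀ (j : ℕ) (z : Site d) (κ : Fin d), linQIter L (c • A) j z κ = c • linQIter L A j z κ
  | 0, _, _ => rfl
  | j + 1, z, κ => by
    have hfun : linQIter L (c • A) j = c • linQIter L A j :=
      funext fun z' => funext fun κ' => linQIter_csmul L c A j z' κ'
    rw [linQIter_succ, hfun, linQ_csmul, linQIter_succ]

omit [CompleteSpace 𝔸] in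
/-- `L^jη·Q_j(1)0 = 0` — bookkeeping. [folklore] -/
theorem linQIter_zero_field (L : ℕ) (j : ℕ) (z : Site d) (κ : Fin d) :
    linQIter L (0 : Site d → Fin d → 𝔸) j z κ = 0 := by
  simpa using linQIter_csmul L (0 : ℂ) (0 : Site d → Fin d → 𝔸) j z κ

omit [CompleteSpace 𝔸] in
/-- The composed linear part `L^jη·(Q_j(1)A)_c` is analytic in any analytic parametrisation of the bond variables
(iterate of `B7Prop3Flat.analyticAt_linQ`: finite sums of real multiples of the `A(Γ)`). [folklore] -/
theorem analyticAt_linQIter (L : ℕ) (B : E → Site d → Fin d → 𝔸) {t₀ : E}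
    (hBa : ∀ x κ, AnalyticAt ℂ (fun t => B t x κ) t₀) :
    ∀ (j : ℕ) (z : Site d) (κ : Fin d), AnalyticAt ℂ (fun t => linQIter L (B t) j z κ) t₀
  | 0, z, κ => hBa z κ
  | j + 1, z, κ => by
    simpa only [linQIter_succ] using
      analyticAt_linQ (fun t => linQIter L (B t) j) (fun x κ' => analyticAt_linQIter L B hBa j x κ') L
        ((L : ℤ) • z) κ

/-- `c₄(d)/L^k > 0` — bookkeeping. [folklore] -/
theorem c4_div_pow_pos (d L : ℕ) (hL : 1 ≤ L) (k : ℕ) : 0 < c4 d / (L : ℝ) ^ k := by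
  have hC1 := C1_pos d
  have hL0 : 0 < L := hL
  unfold c4; positivity

/-- `b ≤ c₄(d)/L^k` ⇒ `8C₁(d)·L^k·b ≤ 1` (`c₄ = 1/(8C₁)`; print's "α₁ ≤ c₄" with `L^kη = 1`) — bookkeeping.
[cite: Balaban1985Averaging, Prop. 4 p.38, (131) p.38] -/
theorem smallness_of_le_c4_div (d L : ℕ) (hL : 1 ≤ L) (k : ℕ) {b : ℝ} (hb : b ≤ c4 d / (L : ℝ) ^ k) :
    8 * C1 d * ((L : ℝ) ^ k * b) ≤ 1 := by
  have hC1 := C1_pos d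
  have hL0 : 0 < L := hL
  have hLk : (0 : ℝ) < (L : ℝ) ^ k := by positivity
  have h1 : (L : ℝ) ^ k * b ≤ c4 d := by
    rw [mul_comm]; exact (le_div_iff₀ hLk).1 hb
  have h := mul_le_mul_of_nonneg_left h1 (by positivity : (0 : ℝ) ≤ 8 * C1 d)
  rwa [c4, mul_one_div_cancel (by positivity)] at h

/-- **Prop. 4 at `U₀ = 1`, THE PRINTED LETTER of the analyticity clause for the composite (127)**: p. 38 "for `α₀,
α₁ ≤ c₄` the function `Q_k(U₀, ηA, c)` … is an analytic function of the variables `A_b`, `b ⊂ B^k(c₋)∪B^k(c₊)`": for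
every finite set `S` of bonds of `ℤ^d`, the function `𝔸^S → 𝔸`, `(A_b)_{b∈S} ↦ Q_k(1, A)(c)` [`U₁ = e^{A}` on `S`,
`U₁ = 1` off `S`: `B7Prop3Flat.insCfg`], is analytic on a neighbourhood of every point of the open polydisc
`{∀ b ∈ S, ‖A_b‖ < c₄(d)/L^k}` (print's `|A| < α₁ ≤ c₄` for `A` on the `L^{−k}`-lattice: `L^k‖B_b‖` plays `|A_b|`,
header DICTIONARY); with `S ⊇` the bonds of `B^k(c₋) ∪ B^k(c₊)` (read on the unit lattice) this is the printed clause at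
the flat background — the case `k = 1` is `B7Prop3Flat.prop3_flat_analyticOnNhd_ins`.
[cite: Balaban1985Averaging, Prop. 4 p.38, (109) p.34, p.31] -/
theorem prop4_flat_analyticOnNhd_ins (S : Finset (Site d × Fin d)) (L : ℕ) (hL : 2 ≤ L) (k : ℕ)
    (z : Site d) (κ : Fin d) :
    AnalyticOnNhd ℂ (fun a : S → 𝔸 => logIter L (insCfg S a) k z κ)
      {a | ∀ s, ‖a s‖ < c4 d / (L : ℝ) ^ k} := by
  intro a ha
  have hL1 : 1 ≤ L := le_trans (by norm_num) hL
  have hna : ‖a‖ < c4 d / (L : ℝ) ^ k := (pi_norm_lt_iff (c4_div_pow_pos d L hL1 k)).2 ha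
  exact prop4_flat_analyticAt L hL (fun a' : S → 𝔸 => insCfg S a') (fun x κ' => analyticAt_insCfg S x κ' a)
    (norm_nonneg a) (fun x κ' => norm_insCfg_le S a x κ') k (smallness_of_le_c4_div d L hL1 k hna.le)
    k le_rfl z κ

omit [NormedAlgebra ℂ 𝔸] [CompleteSpace 𝔸] in
/-- The open polydisc `{a ∈ 𝔸^S : ∀ s, ‖a s‖ < r}` is open (finite intersection) — bookkeeping. [folklore] -/
theorem isOpen_polydisc (S : Finset (Site d × Fin d)) (r : ℝ) :
    IsOpen {a : S → 𝔸 | ∀ s, ‖a s‖ < r} := by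
  rw [Set.setOf_forall]
  exact isOpen_iInter_of_finite fun s =>
    isOpen_lt (continuous_norm.comp (continuous_apply s)) continuous_const

/-- **Prop. 4 at `U₀ = 1`, the analyticity clause for `Q_k(U₀, ηA, c) = (1/i) log(U̿₁^k)_c` ITSELF** (Prop. 4 defines
`Q_k` as the logarithm of the `k`-th order average (90)/(91); (127) identifies it with the composite): for `k ≥ 1` the
function `(A_b)_{b∈S} ↦ (1/i) log U̿₁^k(c)[U₁ = e^{A} on S]` — `mlog (dbavgIter L (e^{insCfg S a}) k (z, κ))` — is
analytic on a neighbourhood of every point of the polydisc `{∀ b ∈ S, ‖A_b‖ < c₄(d)/L^k}`, on which it coincides with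
the composite (`mlog_dbavgIter`). [cite: Balaban1985Averaging, Prop. 4 p.38, (127) p.37, (90)–(91) p.31] -/
theorem prop4_flat_analyticOnNhd_mlog_ins (S : Finset (Site d × Fin d)) (L : ℕ) (hL : 2 ≤ L) (k : ℕ)
    (z : Site d) (κ : Fin d) :
    AnalyticOnNhd ℂ (fun a : S → 𝔸 => mlog ((dbavgIter L (expCfg (insCfg S a)) (k + 1) z κ : 𝔸ˣ) : 𝔸))
      {a | ∀ s, ‖a s‖ < c4 d / (L : ℝ) ^ (k + 1)} := by
  have hL1 : 1 ≤ L := le_trans (by norm_num) hL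
  refine (prop4_flat_analyticOnNhd_ins S L hL (k + 1) z κ).congr (isOpen_polydisc S _) fun a ha => ?_
  have hna : ‖a‖ < c4 d / (L : ℝ) ^ (k + 1) := (pi_norm_lt_iff (c4_div_pow_pos d L hL1 (k + 1))).2 ha
  have hkb : (L : ℝ) ^ (k + 1) * ‖a‖ ≤ c4 d := by
    have hL0 : 0 < L := hL1
    rw [mul_comm]; exact (le_div_iff₀ (by positivity)).1 hna.le
  exact (mlog_dbavgIter L hL (insCfg S a) (norm_nonneg a) (fun x κ' => norm_insCfg_le S a x κ') k hkb z κ).symm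

/-- **Prop. 4 at `U₀ = 1` on `𝔸^S`, the bounds (134)–(135) and (131)**: on the CLOSED polydisc `{∀ b ∈ S, ‖A_b‖ ≤
c₄(d)/L^k}`, `k ≥ 1`: `‖(1/i) log U̿₁^k(c) − L^kη·(Q_k(1)A)_c‖ ≤ C₂(d)·(L^k‖A‖_∞)²` ("|C_k(U₀, A)| ≤ C₂|A|²"),
`‖(1/i) log U̿₁^k(c)‖ ≤ 2L^k‖A‖_∞`, and `U̿₁^k(c) = exp((1/i) log U̿₁^k(c))` (v1 `prop4_flat` transported through the
insertion; `‖A‖_∞ = sup_{b∈S} ‖A_b‖`). [cite: Balaban1985Averaging, Prop. 4 (134)–(135) p.38, (131) p.38] -/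
theorem prop4_flat_ins (S : Finset (Site d × Fin d)) (L : ℕ) (hL : 2 ≤ L) (k : ℕ) (hk : 1 ≤ k) (z : Site d)
    (κ : Fin d) {a : S → 𝔸} (ha : ∀ s, ‖a s‖ ≤ c4 d / (L : ℝ) ^ k) :
    ‖mlog ((dbavgIter L (expCfg (insCfg S a)) k z κ : 𝔸ˣ) : 𝔸) - linQIter L (insCfg S a) k z κ‖
        ≤ C2 d * ((L : ℝ) ^ k * ‖a‖) ^ 2 ∧
      ‖mlog ((dbavgIter L (expCfg (insCfg S a)) k z κ : 𝔸ˣ) : 𝔸)‖ ≤ 2 * ((L : ℝ) ^ k * ‖a‖) ∧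
      ((dbavgIter L (expCfg (insCfg S a)) k z κ : 𝔸ˣ) : 𝔸)
        = exp (mlog ((dbavgIter L (expCfg (insCfg S a)) k z κ : 𝔸ˣ) : 𝔸)) := by
  have hL1 : 1 ≤ L := le_trans (by norm_num) hL
  have hL0 : 0 < L := hL1
  have hna : ‖a‖ ≤ c4 d / (L : ℝ) ^ k := (pi_norm_le_iff_of_nonneg (c4_div_pow_pos d L hL1 k).le).2 ha
  have hkb : (L : ℝ) ^ k * ‖a‖ ≤ c4 d := by
    rw [mul_comm]; exact (le_div_iff₀ (by positivity)).1 hna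
  exact prop4_flat L hL (insCfg S a) (norm_nonneg a) (fun x κ' => norm_insCfg_le S a x κ') k hk hkb z κ

/-- DIRECTIONAL COMPLEX DERIVATIVE of `A ↦ Q_k(1, A)(c)` at `A = 0` on `𝔸^S` in the direction `v` — the differential
(137) "dF(A, δA) = (d/dt) F(A + tδA)|_{t=0}" at `A = 0`, `δA = v`: it equals the composed linear part
`L^kη·(Q_k(1)v)_c` = `linQIter L (insCfg S v) k z κ`, from the quadratic bound (130) along the complex line `t ↦ tv`
(`‖Q_k(1, tv) − L^kη·Q_k(1)(tv)‖ ≤ 8C₁(L^k|t|‖v‖)²`, `prop4_flat_induction` (ii)) and the homogeneity `linQIter_csmul`.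
[cite: Balaban1985Averaging, (137) p.39, (130) p.38, (134) p.38] -/
theorem hasDerivAt_logIter_ins_dir (S : Finset (Site d × Fin d)) (L : ℕ) (hL : 2 ≤ L) (k : ℕ) (z : Site d)
    (κ : Fin d) (v : S → 𝔸) :
    HasDerivAt (fun t : ℂ => logIter L (insCfg S (t • v)) k z κ) (linQIter L (insCfg S v) k z κ) 0 := by
  have hC1 := C1_pos d
  have hL1 : 1 ≤ L := le_trans (by norm_num) hL
  have hL0 : 0 < L := hL1
  have hM0 : (0 : ℝ) < (L : ℝ) ^ k := by positivity
  rw [hasDerivAt_iff_isLittleO_nhds_zero]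
  have h0 : logIter L (insCfg S ((0 : ℂ) • v)) k z κ = 0 := by
    rw [zero_smul, insCfg_zero, logIter_zero_field L hL1 k]; rfl
  refine (Asymptotics.IsBigO.of_bound (8 * C1 d * ((L : ℝ) ^ k * ‖v‖) ^ 2) ?_).trans_isLittleO
    (Asymptotics.isLittleO_pow_id (one_lt_two))
  rw [Metric.eventually_nhds_iff]
  refine ⟨1 / (8 * C1 d * ((L : ℝ) ^ k * ‖v‖ + 1)), by positivity, fun h hh => ?_⟩
  rw [dist_zero_right] at hh
  have hsmall : 8 * C1 d * ((L : ℝ) ^ k * (‖h‖ * ‖v‖)) ≤ 1 := by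
    have hpos : (0 : ℝ) < 8 * C1 d * ((L : ℝ) ^ k * ‖v‖ + 1) := by positivity
    have h1 : ‖h‖ * (8 * C1 d * ((L : ℝ) ^ k * ‖v‖ + 1)) ≤ 1 := by
      have := mul_le_mul_of_nonneg_right hh.le hpos.le
      rwa [one_div, inv_mul_cancel₀ hpos.ne'] at this
    nlinarith [norm_nonneg h, norm_nonneg v, hM0.le, hC1.le, mul_nonneg hC1.le (norm_nonneg h),
      mul_nonneg (mul_nonneg hC1.le (norm_nonneg h)) hM0.le]
  have hbnd : ∀ x κ', ‖insCfg S (h • v) x κ'‖ ≤ ‖h‖ * ‖v‖ := fun x κ' =>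
    (norm_insCfg_le S (h • v) x κ').trans (norm_smul h v).le
  obtain ⟨-, hE, -⟩ := prop4_flat_induction L hL (insCfg S (h • v)) (by positivity) hbnd k hsmall k le_rfl
  have hlin : h • linQIter L (insCfg S v) k z κ = linQIter L (insCfg S (h • v)) k z κ := by
    rw [insCfg_smul, linQIter_csmul]
  rw [zero_add, h0, sub_zero, hlin, norm_pow]
  calc ‖logIter L (insCfg S (h • v)) k z κ - linQIter L (insCfg S (h • v)) k z κ‖
      ≤ 8 * C1 d * ((L : ℝ) ^ k * (‖h‖ * ‖v‖)) ^ 2 := hE z κ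
    _ = 8 * C1 d * ((L : ℝ) ^ k * ‖v‖) ^ 2 * ‖h‖ ^ 2 := by ring

/-- **(134) IN FRÉCHET FORM AT `U₀ = 1`**: on `𝔸^S` the map `A ↦ Q_k(1, A)(c)` is Fréchet-differentiable at `A = 0`
and its derivative there is the continuous linear form `A ↦ L^kη·(Q_k(1)A)_c` — "Q_k(U₀, ηA) = Q_k(U₀)A + C_k(U₀, A)"
(134) with `Q_k(U₀)` "the composition … of their linear parts" (p. 38) and `C_k` of second order ((135)–(136)), at the
flat background. [cite: Balaban1985Averaging, (134) p.38, p.38 (before (130)), (136) p.39] -/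
theorem hasFDerivAt_logIter_ins (S : Finset (Site d × Fin d)) (L : ℕ) (hL : 2 ≤ L) (k : ℕ) (z : Site d)
    (κ : Fin d) :
    ∃ Λ : (S → 𝔸) →L[ℂ] 𝔸,
      HasFDerivAt (fun a : S → 𝔸 => logIter L (insCfg S a) k z κ) Λ 0 ∧
        ∀ v, Λ v = linQIter L (insCfg S v) k z κ := by
  have hL1 : 1 ≤ L := le_trans (by norm_num) hL
  set f : (S → 𝔸) → 𝔸 := fun a => logIter L (insCfg S a) k z κ with hf
  have han : AnalyticAt ℂ f 0 :=
    prop4_flat_analyticOnNhd_ins S L hL k z κ 0 fun s => by simpa using c4_div_pow_pos d L hL1 k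
  have hF : HasFDerivAt f (fderiv ℂ f 0) 0 := han.differentiableAt.hasFDerivAt
  refine ⟨fderiv ℂ f 0, hF, fun v => ?_⟩
  have hg : HasDerivAt (fun t : ℂ => t • v) v 0 := by
    simpa using (hasDerivAt_id (0 : ℂ)).smul_const v
  have hF' : HasFDerivAt f (fderiv ℂ f 0) ((0 : ℂ) • v) := by rwa [zero_smul]
  have h1 : HasDerivAt (f ∘ fun t : ℂ => t • v) (fderiv ℂ f 0 v) 0 := hF'.comp_hasDerivAt (0 : ℂ) hg
  exact h1.unique (hasDerivAt_logIter_ins_dir S L hL k z κ v)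

omit [CompleteSpace 𝔸] in
/-- The composed linear part `A ↦ L^kη·(Q_k(1)A)_c` on `𝔸^S` is its own Fréchet derivative at `0` (it is a continuous
linear form). [cite: Balaban1985Averaging, (125) p.36, p.38 (before (130))] -/
theorem hasFDerivAt_linQIter_ins (S : Finset (Site d × Fin d)) (L : ℕ) (k : ℕ) (z : Site d) (κ : Fin d) :
    ∃ Λ : (S → 𝔸) →L[ℂ] 𝔸,
      HasFDerivAt (fun a : S → 𝔸 => linQIter L (insCfg S a) k z κ) Λ 0 ∧
        ∀ v, Λ v = linQIter L (insCfg S v) k z κ := by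
  set g : (S → 𝔸) → 𝔸 := fun a => linQIter L (insCfg S a) k z κ with hg
  have han : AnalyticAt ℂ g 0 :=
    analyticAt_linQIter L (insCfg S) (fun x κ' => analyticAt_insCfg S x κ' 0) k z κ
  have hG : HasFDerivAt g (fderiv ℂ g 0) 0 := han.differentiableAt.hasFDerivAt
  refine ⟨fderiv ℂ g 0, hG, fun v => ?_⟩
  have hs : HasDerivAt (fun t : ℂ => t • v) v 0 := by
    simpa using (hasDerivAt_id (0 : ℂ)).smul_const v
  have hG' : HasFDerivAt g (fderiv ℂ g 0) ((0 : ℂ) • v) := by rwa [zero_smul]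
  have h1 : HasDerivAt (g ∘ fun t : ℂ => t • v) (fderiv ℂ g 0 v) 0 := hG'.comp_hasDerivAt (0 : ℂ) hs
  have h2 : HasDerivAt (fun t : ℂ => linQIter L (insCfg S (t • v)) k z κ) (linQIter L (insCfg S v) k z κ) 0 := by
    simp only [insCfg_smul, linQIter_csmul]
    simpa using (hasDerivAt_id (0 : ℂ)).smul_const (linQIter L (insCfg S v) k z κ)
  exact h1.unique h2

/-- **Prop. 4 at `U₀ = 1`, THE REMAINDER `C_k(1, A) := Q_k(1, A) − L^kη·Q_k(1)A` ON `𝔸^S` — (136) begins at second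
order**: `A ↦ C_k(1, A)(c)` is analytic on a neighbourhood of every point of the polydisc `{‖A_b‖ < c₄(d)/L^k}`,
`C_k(1, 0)(c) = 0`, and its Fréchet derivative at `A = 0` VANISHES — p. 39: "The function `C_k` can be decomposed
further into a sum of homogeneous polynomials, `C_k(U₀, A) = C_k^{(2)}(U₀, A) + C_k^{(3)}(U₀, A) + …` . (136)" (no terms
of order `0` and `1`; with the bound `‖C_k‖ ≤ C₂(L^kb)²` of (135), v1 `prop4_flat`).
[cite: Balaban1985Averaging, (134)–(135) p.38, (136) p.39] -/
theorem prop4_flat_Ck_ins (S : Finset (Site d × Fin d)) (L : ℕ) (hL : 2 ≤ L) (k : ℕ) (z : Site d)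
    (κ : Fin d) :
    AnalyticOnNhd ℂ (fun a : S → 𝔸 => logIter L (insCfg S a) k z κ - linQIter L (insCfg S a) k z κ)
        {a | ∀ s, ‖a s‖ < c4 d / (L : ℝ) ^ k} ∧
      logIter L (insCfg S (0 : S → 𝔸)) k z κ - linQIter L (insCfg S (0 : S → 𝔸)) k z κ = 0 ∧
      HasFDerivAt (fun a : S → 𝔸 => logIter L (insCfg S a) k z κ - linQIter L (insCfg S a) k z κ)
        (0 : (S → 𝔸) →L[ℂ] 𝔸) 0 := by
  have hL1 : 1 ≤ L := le_trans (by norm_num) hL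
  refine ⟨?_, ?_, ?_⟩
  · exact (prop4_flat_analyticOnNhd_ins S L hL k z κ).sub fun a _ =>
      analyticAt_linQIter L (insCfg S) (fun x κ' => analyticAt_insCfg S x κ' a) k z κ
  · rw [insCfg_zero, logIter_zero_field L hL1 k, linQIter_zero_field, Pi.zero_apply, Pi.zero_apply, sub_zero]
  · obtain ⟨Λ, hF, hΛ⟩ := hasFDerivAt_logIter_ins (𝔸 := 𝔸) S L hL k z κ
    obtain ⟨Λ', hG, hΛ'⟩ := hasFDerivAt_linQIter_ins (𝔸 := 𝔸) S L k z κ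
    have hΛΛ' : Λ - Λ' = 0 := by
      rw [sub_eq_zero]; exact ContinuousLinearMap.ext fun v => by rw [hΛ, hΛ']
    have h := hF.fun_sub hG
    rw [hΛΛ'] at h
    exact h

/-- **(136) AT `U₀ = 1` AS A STATEMENT ABOUT THE POWER SERIES**: `C_k(1, ·)(c)` has a power-series expansion at
`A = 0` on `𝔸^S`, `C_k(1, A)(c) = Σ_n p_n(A, …, A)` (`p_n` a continuous `n`-linear map, `p_n(A, …, A)` = the
homogeneous polynomial `C_k^{(n)}(1, A)` of degree `n`), and its terms of order `0` and `1` vanish: `p₀ = 0`, `p₁ = 0` —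
"C_k(U₀, A) = C_k^{(2)}(U₀, A) + C_k^{(3)}(U₀, A) + …" (136). [cite: Balaban1985Averaging, (136) p.39] -/
theorem prop4_flat_Ck_powerSeries (S : Finset (Site d × Fin d)) (L : ℕ) (hL : 2 ≤ L) (k : ℕ) (z : Site d)
    (κ : Fin d) :
    ∃ p : FormalMultilinearSeries ℂ (S → 𝔸) 𝔸,
      HasFPowerSeriesAt (fun a : S → 𝔸 => logIter L (insCfg S a) k z κ - linQIter L (insCfg S a) k z κ) p 0 ∧
        p 0 = 0 ∧ p 1 = 0 := by
  have hL1 : 1 ≤ L := le_trans (by norm_num) hL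
  obtain ⟨hAn, h0, hD⟩ := prop4_flat_Ck_ins (𝔸 := 𝔸) S L hL k z κ
  obtain ⟨p, hp⟩ := hAn 0 fun s => by simpa using c4_div_pow_pos d L hL1 k
  refine ⟨p, hp, ?_, ?_⟩
  · ext v
    rw [hp.coeff_zero v]
    simpa using h0
  · have h1 := hp.fderiv_eq
    rw [hD.fderiv] at h1
    exact (continuousMultilinearCurryFin1 ℂ (S → 𝔸) 𝔸).map_eq_zero_iff.1 h1.symm

end AnalyticK

end Literature.MathematicalPhysics.QuantumFieldTheory.Balaban1983to89.B7Prop4Flat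

-- ops-buildfix-2 2026-08-23: no-op re-land to make the build lane rebuild and re-publish this module's artefacts (hub .olean page-truncated in the 18:18Z ENOSPC incident, LEDGER B18-1).
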